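import Summits.CriticalPhenomena.PercolationContinuityZ3.Theorems.SahiMasterFamilyDenseEndSign
import Summits.CriticalPhenomena.PercolationContinuityZ3.Theorems.SahiMasterFamilySparseEndBottom
import Summits.CriticalPhenomena.PercolationContinuityZ3.Theorems.SahiMasterFamilyPCDBridge

/-!
# The dense end of Sahi's hierarchy, VI: the TOP CRITERION at every inclusion-minimal double failure (all orders)

Support file of the master-family programme (crux `NoHeavyLowerTail`, stmt-CriticalPhenomena-4575; cell `prim-masterthm`, seat P4,
unit `prim-masterthm-p4-g7`).  Seat documents HOME/prim-masterthm-p4/CORNERS.md §2b and TECC-NOTES.md (the two-ended corner criterion).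

Gen 5's Theorem D (`SahiMasterFamilyDenseEndSign.sahiE_dpw_dense_end`) computes the leading coefficient of `E_k(μ_{1−q·w}; 1_U)` at the
dense end `q → 0`: `(k−2)! · Σ_c w^c (1 − N(c))` over the CHEAPEST double-failure sets `c` (sets of closed coordinates killing at least two
of the events), `N(c) ∈ {0,1}` the number of killed pairs that SPLIT `c`.  For the identically-zero programme ((EQI-k), the two-ended corner
criterion TECC of CORNERS §2b) one wants the criterion at EVERY inclusion-minimal double-failure set `c`, not only the cheapest ones: the
TOP CORNER `c` is VISIBLE (`N(c) = 0`, no split) ⇒ `E_k ≢ 0`.  This file proves it for all orders, mirroring gen 5's bottom criterion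
(`SahiMasterFamilySparseEndBottom`): the face "coordinates outside `c` open" is realised as the dense weight `dpw (cInd c) q` (intensity
`1 − q` on `c`, `1` off `c`), under which the events agree with their CO-CYLINDER EXTENSIONS `coExt U c i = {a : (a ∩ c) ∪ cᶜ ∈ U_i}`; the
events not killed by `c` extend to the sure event and are stripped by iterated branching (`SahiComplement.sahiE_padded_eq`, positive
coefficient `brCoeff`), and for the killed ones the double-failure sets of the extension are exactly the supersets of `c`, so `c` is their
unique cheapest double failure and Theorem D evaluates the leading coefficient to `(|T(c)|−2)! · (1 − N(c)) = (|T(c)|−2)! > 0`: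

* `coExt`, `mem_reflA_coExt` (closing `b` kills the extension iff closing `b ∩ c` kills the event), `sahiE_dpw_cInd_eq_coExt`;
* `Dmin_coExtSub` (`= {c}`), `Nc_coExtSub_eq_zero` (no split ⇒ `N = 0` for the extension), `denseE_coExtSub_zero`;
* **`exists_pos_forall_sahiE_dpw_pos_of_noSplit`** — THE TOP CRITERION: if `c` is an inclusion-minimal double-failure set of the increasing
  events `U_0,…,U_{k−1}` (nonempty events) and no two events killed by `c` are killed by complementary parts of `c`, then
  `E_k(dpw (cInd c) q; 1_U) > 0` for all sufficiently small `q > 0`; hence `E_k` is not identically zero over product weights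
  (`exists_sahiE_spw_one_ne_zero_of_noSplit`), and, in the master-family vocabulary (`Set ι`, `bernoulliWeight`, interior `p`),
  `not_forall_interior_sahiE_eq_zero_of_spw_one_ne_zero` turns any such witness into the failure of "`E_k(μ_p; 1_U) = 0` for every interior `p`".
With gen 5's bottom criterion this completes the `⇒` half of TECC in Lean: an identically-zero family has `Λ(c) = 0` at every bottom corner and
a split at every top corner.  HONEST FRAMING: a criterion for NON-vanishing (one direction of (EQI-k)); the converse (TECC `⇐`), Sahi `C_k`,
Kahn's Conj. 5 and the master theorem remain OPEN.  [this work]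
-/

namespace Summit.CriticalPhenomena.PercolationContinuityZ3.Theorems

namespace SahiSparseEnd

open Finset Function SahiComplement
open Literature.Combinatorics.Sahi2008

section Main

variable {ι : Type*} [Fintype ι] [DecidableEq ι]

/-! ### The face weight `dpw (cInd c) q` -/

/-- `Σ_ω dpw w q ω = 1`. [this work] -/
theorem sum_dpw (w : ι → ℝ) (q : ℝ) : ∑ ω, dpw w q ω = 1 := by
  rw [dpw_eq_pushWeight, sum_pushWeight, sum_spw]

/-- The dense weight with intensities `1 − q w_e` is the sparse weight `spw x 1` with `x_e = 1 − q w_e`. [this work] -/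
theorem dpw_eq_spw_one (w : ι → ℝ) (q : ℝ) : dpw w q = spw (fun e => 1 - q * w e) 1 := by
  funext ω
  rw [dpw, spw, spw, ← compl_eq_univ_sdiff, ← compl_eq_univ_sdiff, compl_compl, mul_comm]
  simp only [one_mul, sub_sub_cancel]

/-- The face weight `dpw (cInd c) q` is supported on the configurations containing `cᶜ`. [this work] -/
theorem compl_subset_of_dpw_cInd_ne_zero {c : Finset ι} {q : ℝ} {ω : Finset ι} (h : dpw (cInd c) q ω ≠ 0) : ωᶜ ⊆ c :=
  subset_of_spw_cInd_ne_zero h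

/-- The branching coefficient is positive for `s ≥ 2`. [this work] -/
theorem brCoeff_pos {s : ℕ} (hs : 2 ≤ s) (t : ℕ) : 0 < brCoeff s t := by
  rw [brCoeff]
  refine prod_pos fun u _ => ?_
  have h2 : (2 : ℝ) ≤ s := by exact_mod_cast hs
  have hu : (0 : ℝ) ≤ u := Nat.cast_nonneg u
  linarith

/-! ### The co-cylinder extension at `c` -/

section Events

variable {k : ℕ} (U : Fin k → Finset (Finset ι)) (c : Finset ι)

/-- The CO-CYLINDER EXTENSION of the events at `c` (outside coordinates forced open): `a ∈ coExt U c i ↔ (a ∩ c) ∪ cᶜ ∈ U i`. [this work] -/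
def coExt (U : Fin k → Finset (Finset ι)) (c : Finset ι) : Fin k → Finset (Finset ι) :=
  fun i => univ.filter fun a => a ∩ c ∪ cᶜ ∈ U i

variable {U c}

/-- Membership in the co-cylinder extension. [this work] -/
theorem mem_coExt {i : Fin k} {a : Finset ι} : a ∈ coExt U c i ↔ a ∩ c ∪ cᶜ ∈ U i := by
  simp [coExt]

/-- The co-cylinder extension is up-closed. [this work] -/
theorem coExt_up (hU : ∀ i a a', a ∈ U i → a ⊆ a' → a' ∈ U i) (i : Fin k) (a a' : Finset ι) (ha : a ∈ coExt U c i)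
    (haa' : a ⊆ a') : a' ∈ coExt U c i :=
  mem_coExt.2 (hU i _ _ (mem_coExt.1 ha) (union_subset_union (inter_subset_inter_right haa') subset_rfl))

/-- `univ ∈ coExt U c i` (from `univ ∈ U i`). [this work] -/
theorem univ_mem_coExt (huniv : ∀ i, (univ : Finset ι) ∈ U i) (i : Fin k) : (univ : Finset ι) ∈ coExt U c i :=
  mem_coExt.2 (by rw [univ_inter, union_compl]; exact huniv i)

/-- `∅ ∈ coExt U c i ↔ cᶜ ∈ U i` (closing `c` does not kill `U i`). [this work] -/
theorem empty_mem_coExt {i : Fin k} : ∅ ∈ coExt U c i ↔ cᶜ ∈ U i := by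
  rw [mem_coExt, empty_inter, empty_union]

/-- The events killed by closing `c`: `i ∈ Tc (reflFam U) c ↔ cᶜ ∉ U i`. [this work] -/
theorem mem_Tc_reflFam {i : Fin k} : i ∈ Tc (reflFam U) c ↔ cᶜ ∉ U i := by
  rw [mem_Tc, reflFam, mem_reflA]

/-- An event NOT killed by `c` extends to the sure event. [this work] -/
theorem setInd_coExt_eq_one (hU : ∀ i a a', a ∈ U i → a ⊆ a' → a' ∈ U i) {i : Fin k} (hi : cᶜ ∈ U i) :
    setInd (coExt U c i) = 1 := by
  funext a
  rw [setInd_apply, if_pos (mem_coExt.2 (hU i _ _ hi subset_union_right))]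
  rfl

/-- Under the face weight, the events and their co-cylinder extensions have the same functional. [this work] -/
theorem sahiE_dpw_cInd_eq_coExt (q : ℝ) :
    sahiE (dpw (cInd c) q) k (fun i => setInd (U i)) = sahiE (dpw (cInd c) q) k (fun i => setInd (coExt U c i)) := by
  refine sahiE_congr_support _ _ _ _ fun i ω hω => ?_
  have hωc : ωᶜ ⊆ c := compl_subset_of_dpw_cInd_ne_zero hω
  have hcω : cᶜ ⊆ ω := fun x hx => by
    by_contra hxω
    exact (mem_compl.1 hx) (hωc (mem_compl.2 hxω))
  have hω' : ω ∩ c ∪ cᶜ = ω := by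
    ext x
    constructor
    · intro hx
      rcases mem_union.1 hx with h | h
      · exact (mem_inter.1 h).1
      · exact hcω h
    · intro hx
      by_cases hxc : x ∈ c
      · exact mem_union.2 (Or.inl (mem_inter.2 ⟨hx, hxc⟩))
      · exact mem_union.2 (Or.inr (mem_compl.2 hxc))
  simp only [setInd_apply, mem_coExt, hω']

/-- **Closing `b` kills the extension iff closing `b ∩ c` kills the event**: `b ∈ reflA (coExt U c i) ↔ b ∩ c ∈ reflA (U i)`. [this work] -/
theorem mem_reflA_coExt {i : Fin k} {b : Finset ι} : b ∈ reflA (coExt U c i) ↔ b ∩ c ∈ reflA (U i) := by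
  rw [mem_reflA, mem_reflA, mem_coExt]
  have h : bᶜ ∩ c ∪ cᶜ = (b ∩ c)ᶜ := by
    ext x
    simp only [mem_union, mem_inter, mem_compl]
    tauto
  rw [h]

/-! ### The killed sub-family of the extension: its double failures are the supersets of `c` -/

/-- The killed sub-family `V_j = coExt U c (T_j)`, `T = Tc (reflFam U) c` in increasing order. [this work] -/
def coExtSub (U : Fin k → Finset (Finset ι)) (c : Finset ι) : Fin (Tc (reflFam U) c).card → Finset (Finset ι) :=
  subFam (coExt U c) (Tc (reflFam U) c)

/-- `coExtSub U c j = coExt U c (T.orderEmbOfFin rfl j)`. [this work] -/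
theorem coExtSub_apply (j : Fin (Tc (reflFam U) c).card) :
    coExtSub U c j = coExt U c ((Tc (reflFam U) c).orderEmbOfFin rfl j) := rfl

/-- The indices of the killed sub-family are killed: `cᶜ ∉ U (T_j)`. [this work] -/
theorem compl_not_mem_of_sub (j : Fin (Tc (reflFam U) c).card) : cᶜ ∉ U ((Tc (reflFam U) c).orderEmbOfFin rfl j) :=
  mem_Tc_reflFam.1 (orderEmbOfFin_mem _ rfl j)

/-- The killed sub-family is up-closed. [this work] -/
theorem coExtSub_up (hU : ∀ i a a', a ∈ U i → a ⊆ a' → a' ∈ U i) :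
    ∀ j a a', a ∈ coExtSub U c j → a ⊆ a' → a' ∈ coExtSub U c j :=
  fun _ a a' ha haa' => coExt_up hU _ a a' ha haa'

/-- `∅ ∉` the killed sub-family. [this work] -/
theorem coExtSub_empty_not_mem : ∀ j, ∅ ∉ coExtSub U c j :=
  fun j h => compl_not_mem_of_sub j (empty_mem_coExt.1 h)

/-- `univ ∈` the killed sub-family. [this work] -/
theorem coExtSub_univ_mem (huniv : ∀ i, (univ : Finset ι) ∈ U i) : ∀ j, (univ : Finset ι) ∈ coExtSub U c j :=
  fun _ => univ_mem_coExt huniv _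

/-- Reflected failure events of the killed sub-family: `b ∈ A'_j ↔ b ∩ c ∈ A_{T_j}`. [this work] -/
theorem mem_reflFam_coExtSub {j : Fin (Tc (reflFam U) c).card} {b : Finset ι} :
    b ∈ reflFam (coExtSub U c) j ↔ b ∩ c ∈ reflFam U ((Tc (reflFam U) c).orderEmbOfFin rfl j) :=
  mem_reflA_coExt

/-- `c` kills every member of the killed sub-family. [this work] -/
theorem self_mem_reflFam_coExtSub (j : Fin (Tc (reflFam U) c).card) : c ∈ reflFam (coExtSub U c) j := by
  rw [mem_reflFam_coExtSub, inter_self]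
  exact mem_Tc.1 (orderEmbOfFin_mem _ rfl j)

/-- A double failure `b` of the killed sub-family gives the double failure `b ∩ c` of the original family. [this work] -/
theorem inter_mem_doubly_of_mem_doubly_coExtSub {b : Finset ι} (hb : b ∈ doubly (reflFam (coExtSub U c))) :
    b ∩ c ∈ doubly (reflFam U) := by
  have h2 : 2 ≤ (univ.filter fun j => b ∈ reflFam (coExtSub U c) j).card := (mem_filter.1 hb).2
  set e := (Tc (reflFam U) c).orderEmbOfFin rfl with he
  have hle : (univ.filter fun j => b ∈ reflFam (coExtSub U c) j).card ≤ (univ.filter fun i => b ∩ c ∈ reflFam U i).card := by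
    rw [← card_image_of_injective (univ.filter fun j => b ∈ reflFam (coExtSub U c) j) e.injective]
    refine card_le_card fun i hi => ?_
    obtain ⟨j, hj, rfl⟩ := mem_image.1 hi
    exact mem_filter.2 ⟨mem_univ _, mem_reflFam_coExtSub.1 (mem_filter.1 hj).2⟩
  exact mem_filter.2 ⟨mem_univ _, h2.trans hle⟩

variable (hc : c ∈ doubly (reflFam U)) (hmin : ∀ b, b ∈ doubly (reflFam U) → b ⊆ c → b = c)

include hmin in
/-- At an inclusion-minimal double-failure set `c`, every double failure of the killed sub-family contains `c`. [this work] -/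
theorem subset_of_mem_doubly_coExtSub {b : Finset ι} (hb : b ∈ doubly (reflFam (coExtSub U c))) : c ⊆ b := by
  have h := hmin (b ∩ c) (inter_mem_doubly_of_mem_doubly_coExtSub hb) inter_subset_right
  exact h ▸ inter_subset_left

include hc in
/-- `|T(c)| ≥ 2`. [this work] -/
theorem two_le_card_Tc' : 2 ≤ (Tc (reflFam U) c).card := two_le_card_Tc hc

include hc in
/-- `c` is a double failure of the killed sub-family. [this work] -/
theorem self_mem_doubly_coExtSub : c ∈ doubly (reflFam (coExtSub U c)) := by
  refine mem_filter.2 ⟨mem_univ _, ?_⟩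
  rw [filter_true_of_mem fun j _ => self_mem_reflFam_coExtSub j, card_univ, Fintype.card_fin]
  exact two_le_card_Tc hc

include hc hmin in
/-- **The cheapest double failure of the killed sub-family has size `|c|`.** [this work] -/
theorem mTwo_coExtSub (hs : 2 ≤ (Tc (reflFam U) c).card) :
    mTwo (coExtSub U c) hs coExtSub_empty_not_mem = c.card := by
  refine le_antisymm (m2_le_card (self_mem_doubly_coExtSub hc)) ?_
  unfold mTwo m2
  refine le_min' _ _ _ fun x hx => ?_
  obtain ⟨b, hb, rfl⟩ := mem_image.1 hx
  exact card_le_card (subset_of_mem_doubly_coExtSub hmin hb)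

include hc hmin in
/-- **`Dmin` of the killed sub-family is `{c}`.** [this work] -/
theorem Dmin_coExtSub (hs : 2 ≤ (Tc (reflFam U) c).card) : Dmin (coExtSub U c) hs coExtSub_empty_not_mem = {c} := by
  ext b
  rw [Dmin, mem_filter, mTwo_coExtSub hc hmin hs, mem_singleton]
  constructor
  · rintro ⟨hb, hcard⟩
    exact (eq_of_subset_of_card_le (subset_of_mem_doubly_coExtSub hmin hb) hcard.le).symm
  · rintro rfl
    exact ⟨self_mem_doubly_coExtSub hc, rfl⟩

/-! ### No split ⇒ `N(c) = 0` for the killed sub-family -/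

/-- NO SPLIT at `c`: no two distinct events are killed by complementary (disjoint) parts `a ⊔ b = c`. [this work] -/
def NoSplit (U : Fin k → Finset (Finset ι)) (c : Finset ι) : Prop :=
  ∀ i j : Fin k, i ≠ j → ∀ a b : Finset ι, a ∈ reflFam U i → b ∈ reflFam U j → Disjoint a b → a ∪ b ≠ c

/-- **No split ⇒ every pair of the killed sub-family has no non-constant admissible system at `c`, so `N(c) = 0`.** [this work] -/
theorem Nc_coExtSub_eq_zero (hns : NoSplit U c) : Nc (reflFam (coExtSub U c)) c = 0 := by
  rw [Nc]
  refine sum_eq_zero fun S hS => ?_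
  have hS2 : S.card = 2 := (mem_powersetCard.1 hS).2
  refine card_eq_zero.2 (eq_empty_of_forall_notMem fun γ hγ => ?_)
  rw [ncSystems, mem_erase] at hγ
  obtain ⟨hne, hsys⟩ := hγ
  obtain ⟨hF, hdis, hun⟩ := mem_systems.1 hsys
  set m0 : Fin S.card := ⟨0, by omega⟩ with hm0
  set m1 : Fin S.card := ⟨1, by omega⟩ with hm1
  have hm01 : m0 ≠ m1 := fun h => by
    have := congrArg Fin.val h
    simp [hm0, hm1] at this
  have hall : ∀ m : Fin S.card, m = m0 ∨ m = m1 := by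
    rintro ⟨v, hv⟩
    have : v = 0 ∨ v = 1 := by omega
    rcases this with rfl | rfl
    · exact Or.inl rfl
    · exact Or.inr rfl
  -- values lie inside `c` and their union is `c`
  have hsub : ∀ m, γ m ⊆ c := fun m => by rw [← hun]; exact subset_biUnion_of_mem γ (mem_univ m)
  have hcov : c ⊆ γ m0 ∪ γ m1 := by
    rw [← hun]
    refine biUnion_subset.2 fun m _ => ?_
    rcases hall m with rfl | rfl
    · exact subset_union_left
    · exact subset_union_right
  -- membership of the values in the reflected failure events of the ORIGINAL family
  set f := S.orderEmbOfFin rfl with hf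
  set e := (Tc (reflFam U) c).orderEmbOfFin rfl with he
  have hmem : ∀ m, γ m ∈ reflFam U (e (f m)) := fun m => by
    have h1 : γ m ∈ reflFam (coExtSub U c) (f m) := (mem_tr.1 (hF m)).1
    have h2 := mem_reflFam_coExtSub.1 h1
    rwa [inter_eq_left.2 (hsub m)] at h2
  by_cases heq : γ m0 = γ m1
  · -- constant system: contradiction with `γ ≠ const c`
    apply hne
    have h0 : γ m0 = c := Subset.antisymm (hsub m0) (hcov.trans (by rw [← heq, union_idempotent]))
    funext m
    rcases hall m with rfl | rfl
    · exact h0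
    · exact heq ▸ h0
  · -- a genuine split: forbidden
    have hd : Disjoint (γ m0) (γ m1) := (hdis m0 m1).resolve_left heq
    have hu : γ m0 ∪ γ m1 = c := Subset.antisymm (union_subset (hsub m0) (hsub m1)) hcov
    have hij : e (f m0) ≠ e (f m1) := fun h => hm01 (f.injective (e.injective h))
    exact hns _ _ hij _ _ (hmem m0) (hmem m1) hd hu

/-! ### The top criterion -/

variable (hU : ∀ i a a', a ∈ U i → a ⊆ a' → a' ∈ U i) (huniv : ∀ i, (univ : Finset ι) ∈ U i)

include hU huniv hc hmin in
/-- **`Ê'(0) = (|T(c)|−2)!` for the killed sub-family under the face profile `cInd c`, when `c` does not split.** [this work] -/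
theorem denseE_coExtSub_zero (hns : NoSplit U c) (hs : 2 ≤ (Tc (reflFam U) c).card) :
    denseE (cInd c) (coExtSub U c) hs coExtSub_empty_not_mem 0 = (((Tc (reflFam U) c).card - 2).factorial : ℝ) := by
  rw [denseE_zero_eq_sum (coExtSub U c) hs (coExtSub_up hU) coExtSub_empty_not_mem (coExtSub_univ_mem huniv) (cInd c),
    Dmin_coExtSub hc hmin hs, sum_singleton, prod_cInd_self, Nc_coExtSub_eq_zero hns]
  simp

include hU in
/-- Stripping the events not killed by `c`: `E_k(dpw; 1_{coExt}) = brCoeff |T| (k−|T|) · E_{|T|}(dpw; 1_{coExtSub})`. [this work] -/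
theorem sahiE_coExt_eq_brCoeff_mul (q : ℝ) (hs : 1 ≤ (Tc (reflFam U) c).card) :
    sahiE (dpw (cInd c) q) k (fun i => setInd (coExt U c i)) =
      brCoeff (Tc (reflFam U) c).card (k - (Tc (reflFam U) c).card) *
        sahiE (dpw (cInd c) q) (Tc (reflFam U) c).card (fun j => setInd (coExtSub U c j)) :=
  sahiE_padded_eq (sum_dpw (cInd c) q) hs (k - (Tc (reflFam U) c).card) k (fun i => setInd (coExt U c i))
    (Tc (reflFam U) c) rfl rfl fun _ hj => setInd_coExt_eq_one hU (not_not.1 fun h => hj (mem_Tc_reflFam.2 h))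

include hU huniv hc hmin in
/-- **THE TOP CRITERION (all orders).**  Let `U_0,…,U_{k−1}` be increasing events of a finite cube (up-closed, `univ ∈ U_i`), and let `c`
be an INCLUSION-MINIMAL DOUBLE-FAILURE set (closing `c` kills at least two events, no proper subset of `c` does) that does NOT SPLIT (no two
distinct events are killed by disjoint parts `a ⊔ b = c`).  Then under the face weights `dpw (cInd c) q` (intensity `1 − q` on `c`, `1`
off `c`) `E_k(1_U) > 0` for all sufficiently small `q > 0`. [this work] -/
theorem exists_pos_forall_sahiE_dpw_pos_of_noSplit (hns : NoSplit U c) :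
    ∃ δ > 0, ∀ q : ℝ, 0 < q → q < δ → 0 < sahiE (dpw (cInd c) q) k (fun i => setInd (U i)) := by
  have hs : 2 ≤ (Tc (reflFam U) c).card := two_le_card_Tc hc
  have hpos : 0 < denseE (cInd c) (coExtSub U c) hs coExtSub_empty_not_mem 0 := by
    rw [denseE_coExtSub_zero hc hmin hU huniv hns hs]
    exact_mod_cast Nat.factorial_pos _
  obtain ⟨δ, hδ, h⟩ := exists_pos_forall_sahiE_dpw_pos (coExtSub U c) hs (coExtSub_up hU) coExtSub_empty_not_mem (cInd c) hpos
  refine ⟨δ, hδ, fun q hq hqδ => ?_⟩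
  rw [sahiE_dpw_cInd_eq_coExt, sahiE_coExt_eq_brCoeff_mul hU q (by omega)]
  exact mul_pos (brCoeff_pos hs _) (h q hq hqδ)

include hU huniv hc hmin in
/-- Hence `E_k(1_U)` is NOT identically zero over product weights: some `spw x 1` with `x ∈ [0,1]^ι` gives a nonzero (indeed positive) value.
[this work] -/
theorem exists_sahiE_spw_one_ne_zero_of_noSplit (hns : NoSplit U c) :
    ∃ x : ι → ℝ, (∀ e, 0 ≤ x e ∧ x e ≤ 1) ∧ sahiE (spw x 1) k (fun i => setInd (U i)) ≠ 0 := by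
  obtain ⟨δ, hδ, h⟩ := exists_pos_forall_sahiE_dpw_pos_of_noSplit hc hmin hU huniv hns
  set q := min (δ / 2) (1 / 2) with hq
  have hq0 : 0 < q := lt_min (half_pos hδ) (by norm_num)
  have hqδ : q < δ := (min_le_left _ _).trans_lt (half_lt_self hδ)
  have hq1 : q ≤ 1 := (min_le_right _ _).trans (by norm_num)
  refine ⟨fun e => 1 - q * cInd c e, fun e => ?_, ?_⟩
  · simp only [cInd]
    split_ifs
    · constructor <;> nlinarith
    · constructor <;> nlinarith
  · rw [← dpw_eq_spw_one]
    exact (h q hq0 hqδ).ne'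

end Events

end Main

/-! ### Bridge to the master-family vocabulary (`Set ι`, `bernoulliWeight`, interior parameters) -/

section Bridge

open scoped Classical
open Literature.Probability.Percolation.DecisionTree (ind)

universe u

variable {ι : Type u} [Fintype ι]

/-- **A nonzero value under some `spw x 1` refutes "`E_k(μ_p; 1_U) = 0` for every interior `p`"** (`E_k` is a polynomial in the
parameters, tree `forall_sahiE_weight_eq_zero_of_interior`; transport `sahiE_spw_toFinsetFam`). [this work] -/
theorem not_forall_interior_sahiE_eq_zero_of_spw_one_ne_zero {k : ℕ} (U : Fin k → Set (Set ι)) (x : ι → ℝ)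
    (h : sahiE (spw x 1) k (fun j => setInd (toFinsetFam U j)) ≠ 0) :
    ¬ ∀ p : ι → unitInterval, (∀ e, (p e : ℝ) ∈ Set.Ioo (0 : ℝ) 1) → sahiE (bernoulliWeight p) k (fun j => ind (U j)) = 0 :=
  fun hall => h (by rw [sahiE_spw_toFinsetFam]; exact forall_sahiE_weight_eq_zero_of_interior _ hall x)

/-- **The top criterion in the master-family vocabulary.**  For `k` increasing, nonempty events `U_j ⊆ 2^ι` (finite `ι`), with `V = toFinsetFam U`
their finset form: if `c` is an inclusion-minimal double-failure set of `V` that does not split, then it is NOT the case that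
`E_k(μ_p; 1_U) = 0` for every interior `p` — the family is outside the identically-zero locus. [this work] -/
theorem not_forall_interior_sahiE_eq_zero_of_noSplit {k : ℕ} (U : Fin k → Set (Set ι)) (hU : ∀ j, IsUpperSet (U j))
    (hne : ∀ j, (Set.univ : Set ι) ∈ U j) (c : Finset ι) (hc : c ∈ doubly (reflFam (toFinsetFam U)))
    (hmin : ∀ b, b ∈ doubly (reflFam (toFinsetFam U)) → b ⊆ c → b = c) (hns : NoSplit (toFinsetFam U) c) :
    ¬ ∀ p : ι → unitInterval, (∀ e, (p e : ℝ) ∈ Set.Ioo (0 : ℝ) 1) → sahiE (bernoulliWeight p) k (fun j => ind (U j)) = 0 := by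
  have hVup : ∀ j a a', a ∈ toFinsetFam U j → a ⊆ a' → a' ∈ toFinsetFam U j :=
    fun j a a' ha haa' => mem_toFinsetFam.2 (hU j (Finset.coe_subset.2 haa') (mem_toFinsetFam.1 ha))
  have hVuniv : ∀ j, (univ : Finset ι) ∈ toFinsetFam U j := fun j => mem_toFinsetFam.2 (by rw [Finset.coe_univ]; exact hne j)
  obtain ⟨x, -, hx⟩ := exists_sahiE_spw_one_ne_zero_of_noSplit hc hmin hVup hVuniv hns
  exact not_forall_interior_sahiE_eq_zero_of_spw_one_ne_zero U x hx

end Bridge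

end SahiSparseEnd

end Summit.CriticalPhenomena.PercolationContinuityZ3.Theorems
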